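import Summits.HodgeConjecture.HodgeConjecture.Theorems.DerivedTorelliFermatAssembly
import Summits.HodgeConjecture.HodgeConjecture.Theorems.DerivedTorelliFermatHypersurfaceLefschetz
import Literature.AlgebraicGeometry.HodgeTheory.MiddleDimensionReductionProofs
import Literature.AlgebraicGeometry.HodgeTheory.HodgeTypeExteriorProduct
import Literature.AlgebraicGeometry.HodgeTheory.ComplexConjugationHolds

/-!
# Route DerivedTorelliFermat — `ResidualSectorComplement`: exact logical status of the declared frame

Item stmt-HodgeConjecture-13828 (`ResidualSectorComplement := FermatFourfoldsHCModResidual →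
HodgeConjecture`, crux rank 9, "bookkeeping, NOT claimed"): the complement of the route's sector. The
target `FermatFourfoldsHCModResidual` (stmt-HodgeConjecture-14576) concludes `HodgeConjectureFor 4 X`
for smooth projective Fermat fourfolds `X` of degree `m ≥ 1` whose residual eigenlines are algebraic.

This file records, kernel-checked and with no hypotheses beyond the route's own declarations and
LANDED theorems, why the item can be settled in neither direction short of deciding the Clay problem:

* `derivedTorelliFermat_residualSectorComplement_of_hodgeConjecture` : `HC → C` (trivial);
* `derivedTorelliFermat_target_of_hodgeConjecture` : `HC → T` — the sector is a special case of the
  summit (Fermat fourfolds are smooth projective fourfolds; the residual hypothesis is dropped);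
* `derivedTorelliFermat_not_residualSectorComplement_iff` : `¬ C ↔ T ∧ ¬ HC`;
* `derivedTorelliFermat_residualSectorComplement_iff` : `C ↔ ¬ T ∨ HC`;
* `derivedTorelliFermat_hodgeConjecture_iff_target_and_residualSectorComplement` : `HC ↔ T ∧ C`;
* `derivedTorelliFermat_residualSectorComplement_iff_hodgeConjecture` : `T → (C ↔ HC)`, and
  `derivedTorelliFermat_residualSectorComplement_iff_hodgeConjecture_of_items` :
  `EigenspaceInputs → ShiodaAokiSupply → K3SectorAlgebraic → (C ↔ HC)` through the landed
  `derivedTorelliFermat_assembly_proof`, `derivedTorelliFermat_hypersurfaceLefschetz_proof`,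
  `HodgeModels_holds` — once the route has delivered its sector, the frame IS the summit;
* `derivedTorelliFermat_hodgeConjectureFor_of_projectiveLine`, `derivedTorelliFermat_offDimFour_iff`,
  `derivedTorelliFermat_offFermatFourfolds_iff` : the HONEST complement of the sector ("HC for every
  smooth projective variety that is not a Fermat fourfold", even "HC in every dimension `≠ 4`") is
  already EQUIVALENT to `HC`, by the tree's proved ℙ¹-step `X ↦ X × ℙ¹`
  (`mem_algebraicClasses_of_projectiveLine_of_preservesHodgeType`).

Nothing here asserts a Theses decl; every statement is an implication from `HodgeConjecture`, a
negation, an equivalence, or an implication from route items. No new `def … : Prop` is introduced.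
Crux-strategist seat planner-cstrat-stmt-HodgeConjecture-13828-r1-0, 2026-08-17 (companion of
`Cruxes/ResidualSectorComplement/STRATEGY-CENSUS-r1.md` / `StrategistCensusR1.lean`).
-/

set_option linter.dupNamespace false
set_option autoImplicit false

noncomputable section

namespace Summit.HodgeConjecture.HodgeConjecture.Theorems

open CategoryTheory MonoidalCategory CartesianMonoidalCategory
open Summit.HodgeConjecture.HodgeConjecture.Theses.DerivedTorelliFermat
open Literature.AlgebraicGeometry Literature.AlgebraicGeometry.Motives
open Literature.AlgebraicGeometry.HodgeTheory

/-- `HC → ResidualSectorComplement`: the frame is a weakening of the summit. [folklore] -/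
theorem derivedTorelliFermat_residualSectorComplement_of_hodgeConjecture :
    _root_.HodgeConjecture → ResidualSectorComplement :=
  fun hHC _ ↦ hHC

/-- **The sector is a special case of the summit**: `HC → FermatFourfoldsHCModResidual` — a smooth
projective Fermat fourfold is a smooth projective fourfold; the residual hypothesis is not used.
[folklore] -/
theorem derivedTorelliFermat_target_of_hodgeConjecture :
    _root_.HodgeConjecture → FermatFourfoldsHCModResidual :=
  fun hHC _m _ _hR _X _hF hX ↦ hHC hX

/-- Refuting the target refutes the Hodge conjecture. [folklore] -/
theorem derivedTorelliFermat_not_hodgeConjecture_of_not_target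
    (h : ¬ FermatFourfoldsHCModResidual) : ¬ _root_.HodgeConjecture :=
  fun hHC ↦ h (derivedTorelliFermat_target_of_hodgeConjecture hHC)

/-- The exact content of a refutation of the frame: `¬ C ↔ T ∧ ¬ HC`; in particular any refutation
of the frame is a disproof of the Hodge conjecture. [folklore] -/
theorem derivedTorelliFermat_not_residualSectorComplement_iff :
    ¬ ResidualSectorComplement ↔ FermatFourfoldsHCModResidual ∧ ¬ _root_.HodgeConjecture :=
  Classical.not_imp

/-- Any kill of the frame is a disproof of `_root_.HodgeConjecture`. [folklore] -/
theorem derivedTorelliFermat_not_hodgeConjecture_of_not_residualSectorComplement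
    (h : ¬ ResidualSectorComplement) : ¬ _root_.HodgeConjecture :=
  (derivedTorelliFermat_not_residualSectorComplement_iff.1 h).2

/-- Truth table of the frame: `C ↔ ¬ T ∨ HC`. [folklore] -/
theorem derivedTorelliFermat_residualSectorComplement_iff :
    ResidualSectorComplement ↔ ¬ FermatFourfoldsHCModResidual ∨ _root_.HodgeConjecture := by
  constructor
  · intro h
    by_cases hT : FermatFourfoldsHCModResidual
    · exact Or.inr (h hT)
    · exact Or.inl hT
  · rintro (hT | hHC) hT'
    · exact absurd hT' hT
    · exact hHC

/-- `C ↔ (T ↔ HC)`: the frame asserts that the residual-conditional Hodge conjecture for Fermat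
fourfolds is equivalent to the full Hodge conjecture. [folklore] -/
theorem derivedTorelliFermat_residualSectorComplement_iff_target_iff_hodgeConjecture :
    ResidualSectorComplement ↔ (FermatFourfoldsHCModResidual ↔ _root_.HodgeConjecture) :=
  ⟨fun hC ↦ ⟨hC, derivedTorelliFermat_target_of_hodgeConjecture⟩, fun h ↦ h.1⟩

/-- Bookkeeping identity of the D-0027 §2.1 frame: `HC ↔ T ∧ C` — the declared, not-claimed item
is exactly "the Hodge conjecture minus the route's sector". [folklore] -/
theorem derivedTorelliFermat_hodgeConjecture_iff_target_and_residualSectorComplement :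
    _root_.HodgeConjecture ↔ FermatFourfoldsHCModResidual ∧ ResidualSectorComplement :=
  ⟨fun hHC ↦ ⟨derivedTorelliFermat_target_of_hodgeConjecture hHC, fun _ ↦ hHC⟩, fun h ↦ h.2 h.1⟩

/-- Once the route has delivered its target, the frame IS the summit: `T → (C ↔ HC)`. [folklore] -/
theorem derivedTorelliFermat_residualSectorComplement_iff_hodgeConjecture
    (hT : FermatFourfoldsHCModResidual) : ResidualSectorComplement ↔ _root_.HodgeConjecture :=
  ⟨fun h ↦ h hT, fun hHC _ ↦ hHC⟩

/-- The target from the route's three open Fermat-side items, by landed theorems only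
(`derivedTorelliFermat_targetGlue_proof`, `derivedTorelliFermat_hypersurfaceLefschetz_proof`,
`HodgeModels_holds`). [cite: Shioda1979PJA, §2 Thm. 1] [cite: Ran1980, Thm. 4.9] -/
theorem derivedTorelliFermat_target_of_items (hE : EigenspaceInputs) (hS : ShiodaAokiSupply)
    (hK : K3SectorAlgebraic) : FermatFourfoldsHCModResidual :=
  derivedTorelliFermat_targetGlue_proof derivedTorelliFermat_hypersurfaceLefschetz_proof
    HodgeModels_holds hE hS hK

/-- **Modulo the route's open items the frame is literally the summit**:
`EigenspaceInputs → ShiodaAokiSupply → K3SectorAlgebraic → (ResidualSectorComplement ↔ HC)`, the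
forward direction being the landed `derivedTorelliFermat_assembly_proof`. [folklore] -/
theorem derivedTorelliFermat_residualSectorComplement_iff_hodgeConjecture_of_items
    (hE : EigenspaceInputs) (hS : ShiodaAokiSupply) (hK : K3SectorAlgebraic) :
    ResidualSectorComplement ↔ _root_.HodgeConjecture :=
  ⟨fun hC ↦ derivedTorelliFermat_assembly_proof derivedTorelliFermat_hypersurfaceLefschetz_proof
      HodgeModels_holds hE hS hK hC,
    fun hHC _ ↦ hHC⟩

/-! ## The honest complement of a sector of fourfolds is the whole conjecture (ℙ¹-step) -/

/-- **HC for the fivefold `X × ℙ¹` gives HC for the fourfold `X`** (all codimensions), with no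
unproved input: pull back along `fst`, apply HC upstairs, restrict along the zero section
(`mem_algebraicClasses_of_projectiveLine_of_preservesHodgeType`).
[cite: BrosnanFangNiePearlstein2009, §6 Lemma 48 (proof)] -/
theorem derivedTorelliFermat_hodgeConjectureFor_of_projectiveLine {n : ℕ} {X : SchemeOver ℂ}
    (hX : IsSmoothProjective n X)
    (h : HodgeConjectureFor (n + 1) (X ⊗ projectiveSpace 1 ℂ)) : HodgeConjectureFor n X := by
  have hP : IsSmoothProjective 1 (projectiveSpace 1 ℂ) := isSmoothProjective_projectiveSpace_holds ℂ 1
  have hXP : IsSmoothProjective (n + 1) (X ⊗ projectiveSpace 1 ℂ) :=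
    IsSmoothProjective.tensor_holds hX hP
  refine ⟨nonempty_hodgeModel_holds hX, fun p c hc hpp ↦ ?_⟩
  exact mem_algebraicClasses_of_projectiveLine_of_preservesHodgeType hX
    (preservesHodgeType_of_isSmoothProjective hXP hX (fst X (projectiveSpace 1 ℂ)))
    (fun κ hκ hκpp ↦ h.2 p κ hκ hκpp) c hc hpp

/-- **HC off dimension 4 is the whole Hodge conjecture**: excluding ALL fourfolds loses nothing
(`X ↦ X × ℙ¹`). [cite: BrosnanFangNiePearlstein2009, §6 Lemma 48 (proof)] -/
theorem derivedTorelliFermat_offDimFour_iff :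
    (∀ ⦃n : ℕ⦄ ⦃X : SchemeOver ℂ⦄, n ≠ 4 → IsSmoothProjective n X → HodgeConjectureFor n X) ↔
      _root_.HodgeConjecture := by
  constructor
  · intro h n X hX
    by_cases hn : n = 4
    · subst hn
      exact derivedTorelliFermat_hodgeConjectureFor_of_projectiveLine hX
        (h (by norm_num) (IsSmoothProjective.tensor_holds hX (isSmoothProjective_projectiveSpace_holds ℂ 1)))
    · exact h hn hX
  · intro hS n X _ hX
    exact hS hX

/-- **The honest complement of the (enlarged) sector is the summit**: "HC for every smooth
projective variety that is not a Fermat fourfold `X⁴ₘ`, `m ≥ 1`" `↔ HC`. So the typed frame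
`T → HC` is the weakest statement closing the route, and every honest reading of "HC off the
Fermat fourfolds" is `HodgeConjecture` itself. [cite: BrosnanFangNiePearlstein2009, §6 Lemma 48 (proof)] -/
theorem derivedTorelliFermat_offFermatFourfolds_iff :
    (∀ ⦃n : ℕ⦄ ⦃X : SchemeOver ℂ⦄, IsSmoothProjective n X →
        ¬ (n = 4 ∧ ∃ m : ℕ, m ≠ 0 ∧ IsFermatVariety 4 m X) → HodgeConjectureFor n X) ↔
      _root_.HodgeConjecture := by
  constructor
  · intro h
    refine derivedTorelliFermat_offDimFour_iff.1 fun n X hn hX ↦ h hX fun hin ↦ hn hin.1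
  · intro hS n X hX _
    exact hS hX

/-- The frame is equivalent to "the route target (fourfolds only) implies HC in every dimension other
than 4": hypothesis and conclusion live in disjoint dimensions. [folklore] -/
theorem derivedTorelliFermat_residualSectorComplement_iff_target_imp_offDimFour :
    ResidualSectorComplement ↔ (FermatFourfoldsHCModResidual →
      ∀ ⦃n : ℕ⦄ ⦃X : SchemeOver ℂ⦄, n ≠ 4 → IsSmoothProjective n X → HodgeConjectureFor n X) :=
  ⟨fun hC hT ↦ derivedTorelliFermat_offDimFour_iff.2 (hC hT),
    fun h hT ↦ derivedTorelliFermat_offDimFour_iff.1 (h hT)⟩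

/-- **Law of lines** for this crux: any hypothesis `P` concluding the frame is a proof of the summit
from `P ∧ T`. [folklore] -/
theorem derivedTorelliFermat_residualSectorComplement_law_of_lines (P : Prop) :
    (P → ResidualSectorComplement) ↔ (P ∧ FermatFourfoldsHCModResidual → _root_.HodgeConjecture) :=
  ⟨fun h hp ↦ h hp.1 hp.2, fun h hP hT ↦ h ⟨hP, hT⟩⟩

/-- **Sharpened kill shape**: a counterexample to the frame is a proof of the target together with a
non-algebraic Hodge class that may be taken in dimension `≠ 4` — outside the route's universe.
[folklore] -/
theorem derivedTorelliFermat_not_residualSectorComplement_iff_offDimFour :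
    ¬ ResidualSectorComplement ↔ FermatFourfoldsHCModResidual ∧ ∃ (n : ℕ) (X : SchemeOver ℂ),
      n ≠ 4 ∧ IsSmoothProjective n X ∧ ¬ HodgeConjectureFor n X := by
  rw [derivedTorelliFermat_not_residualSectorComplement_iff, ← derivedTorelliFermat_offDimFour_iff]
  refine and_congr_right fun _ ↦ ?_
  constructor
  · intro hn
    by_contra hall
    apply hn
    intro n X hn4 hX
    by_contra hX'
    exact hall ⟨n, X, hn4, hX, hX'⟩
  · rintro ⟨n, X, hn4, hX, hnX⟩ hO
    exact hnX (hO hn4 hX)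

end Summit.HodgeConjecture.HodgeConjecture.Theorems

end
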